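import Summits.BirchSwinnertonDyer.Rank1Residual.Additive.QuadraticTwistTransportDecomposition
import Summits.BirchSwinnertonDyer.Rank1Residual.Additive.CyclotomicThreeRankOneOneTwistDescentData
import HarnessLib

/-!
# The INDEX of a twisting transport: `m ∣ 2` in rank `(1,0)` and `ad − bc ∣ 4` in rank `(1,1)`
# (cell `b2b-bsdres`, team n1011, seat p16 GEN 12; row T-IDX2 FILE 2 — the mechanism that removes
# Milne's A73 from the ranks-`(1,0)`/`(1,1)` `K`-side LOWER lines `XGordRankOne{Zero,One}CyclotomicThreeLowerK`)

HONEST FRAMING (cell `b2b-bsdres`, run/shared/lean/b2b/bsd-rank1-residual/, verbatim in every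
file): the goal of the cell is to DELETE the COMBINATION-SHAPED residual classes of the
Birch–Swinnerton-Dyer formula for ALL analytic-rank `≤ 1` elliptic curves over `ℚ` — "full BSD
formula for every rank `≤ 1` curve in class `C`" assembled STRICTLY from published theorems — so
that the rank-`≤ 1` remainder becomes exactly the CONSTRUCTION-SHAPED classes, which are TYPED
(missing-input `Prop`s), NOT attempted. This is not "finishing BSD". Team n1011 (N10 / N11 / O7),
seat p16: research route; the labels of X3 / X4 and the N10 / N11 / O7 marks are UNCHANGED by this
file; nothing is booked here; no Literature fact is minted; no definition.

TOOL theorems only (no `def`, no `sorry`, no named fact). The rank-one `K`-side LOWER cores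
`XGordRankOneZeroCyclotomicThreeLowerK` / `XGordRankOneOneCyclotomicThreeLowerK` read Milne's
Weil-restriction identity (A73, `hMilne`) through `padicVal_card_identity_rankOne{Zero,One}`, which
keep an INDEX TERM `2·ord_p m` / `2·ord_p M` (`Tr P₁ = m•Q + t`; `M = ad − bc` for `ιP₀ = aB₀ + bB₁ + t`,
`ΦP₁ = cB₀ + dB₁ + t'`), whereas the Milne-free T-MIL-CAN FILE 4 identity
`padicVal_card_identity_baseChange_anyRank_of_natAbs_discr_eq` has none. This file PROVES that the index
term vanishes at every odd `p`, for EVERY admissible transport, from the eigenspace decomposition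
`2·V(K) ⊆ ι(V(ℚ)) + Φ(W(ℚ))` of `QuadraticTwistTransportDecomposition` (`exists_conj_twistTransport_decomp`):

* §1 bookkeeping — the one-element basis decomposition on the group law of ANY `DecidableEq` instance
  (`exists_eq_zsmul_add_torsion_one_of_decEq`), additivity / torsion of `ι : V(ℚ) → V(K)`, uniqueness
  of coefficients on a two-element Mordell–Weil basis modulo torsion;
* §2 **`twistTransport_index_dvd_two`** (rank `(1,0)`): `V(ℚ)` finite, `{P₁}` a Mordell–Weil basis of
  `W(ℚ)`, `{Q}` one of `V(K)`, and ANY additive `Tr : W(ℚ) →+ V(K)` doubling Néron–Tate heights with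
  `Tr P₁ = m•Q + t` (`t` torsion): **`m ∣ 2`** — the canonical `Φ` has `ΦP₁ = m₀•Q + t₀` with `m₀ ∣ 2`
  by the decomposition of `Q`, and `m²·ĥ(Q) = 2ĥ(P₁) = m₀²·ĥ(Q)` (`heightPairing_twistGenerator_eq`),
  `ĥ(Q) = Reg(V_K) > 0`; so `m ≠ 0` and `padicValRat p m = 0` for odd `p`
  (`padicValRat_twistTransport_index_eq_zero`);
* §3 **`twistTransport_indexDet_dvd_four`** (rank `(1,1)`): `{P₀}`, `{P₁}`, `B = (B₀,B₁)` Mordell–Weil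
  bases of `V(ℚ)`, `W(ℚ)`, `V(K)`, ANY `σ : K →ₐ[ℚ] K` and height-doubling `σ`-anti-invariant `Φ` with
  `ιP₀ = aB₀ + bB₁ + t`, `ΦP₁ = cB₀ + dB₁ + t'`: **`ad − bc ∣ 4`** — for the canonical pair the matrix of
  `(2B₀, 2B₁)` in `(ιP₀, Φ₀P₁)` is integral by the decomposition, so `M₀ · det = 4`; and
  `M²·Reg(V_K) = 4Reg(V)Reg(W) = M₀²·Reg(V_K)` (`sq_mul_regulator_baseChange_eq_rankOneOne`, Galois
  orthogonality), `Reg(V_K) > 0`; so `padicValRat p (ad − bc) = 0` for odd `p`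
  (`padicValRat_twistTransport_indexDet_eq_zero`).

References: [cite: SilvermanAEC2009, Exercise 10.16, Prop. VIII.5.4(b), Thm. VIII.9.3];
[cite: BombieriGubler2001, Prop. 1.5.17].
-/

noncomputable section

open scoped Classical

open WeierstrassCurve WeierstrassCurve.Affine.Point Literature.NumberTheory.EllipticCurves NumberField
  Literature.NumberTheory.QuadraticFields

namespace Summit.BirchSwinnertonDyer.Rank1Residual.Additive

/-! ## §1 Bookkeeping on `V(ℚ)`, `W(ℚ)` and two-element bases of `V(K)` -/

section Bookkeeping

variable (K : Type) [Field K] [NumberField K] (V : WeierstrassCurve ℚ)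

/-- The one-element Mordell–Weil basis decomposition `P = m•Q + t` (`t` torsion;
`exists_eq_zsmul_add_torsion_of_isMordellWeilBasis_one`) read on the group law of points defined from
ANY `DecidableEq` instance of the base field (Mathlib's chord–tangent law takes `[DecidableEq F]`; any
two instances are equal, `Subsingleton.elim`; over `ℚ` the generic lemma carries the classical instance
while statements elaborate `Rat`'s — cf. `exists_addMonoidHom_coe_eq_of_decEq`). [folklore] -/
theorem exists_eq_zsmul_add_torsion_one_of_decEq {F : Type*} [Field F] {E : WeierstrassCurve F}
    (d : DecidableEq F) {Q : E.toAffine.Point} (hQ : IsMordellWeilBasis (fun _ : Fin 1 => Q))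
    (P : E.toAffine.Point) :
    letI : DecidableEq F := d
    ∃ (m : ℤ) (t : E.toAffine.Point), IsOfFinAddOrder t ∧ P = m • Q + t := by
  have h : (fun a b => Classical.propDecidable (a = b) : DecidableEq F) = d := Subsingleton.elim _ _
  subst h
  exact exists_eq_zsmul_add_torsion_of_isMordellWeilBasis_one hQ P

/-- `ι : V(ℚ) → V(K)` (`pointToBaseChange`, Mathlib's base change of points read on `V(ℚ)`,
`pointToBaseChange_eq_baseChange`) is additive: `ι(k•P + s) = k•ι(P) + ι(s)` (the `zsmul` form of
`WeierstrassCurve.pointToBaseChange_add` of `CanonicalPAdicHeightRestrictionProofs`, not imported here so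
that the `K`-side LOWER cores do not acquire the canonical-`p`-adic-height lane). [folklore] -/
theorem pointToBaseChange_zsmul_add (k : ℤ) (P s : V.toAffine.Point) :
    V.pointToBaseChange K (k • P + s) = k • V.pointToBaseChange K P + V.pointToBaseChange K s := by
  rw [pointToBaseChange_eq_baseChange, pointToBaseChange_eq_baseChange, pointToBaseChange_eq_baseChange]
  have h1 := map_add (Affine.Point.baseChange (W' := V) ℚ K) (k • P) s
  rw [map_zsmul] at h1
  exact h1

/-- `ι : V(ℚ) → V(K)` preserves finite order (one direction of
`WeierstrassCurve.isOfFinAddOrder_pointToBaseChange_iff`, same remark). [folklore] -/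
theorem isOfFinAddOrder_pointToBaseChange {s : V.toAffine.Point} (hs : IsOfFinAddOrder s) :
    IsOfFinAddOrder (V.pointToBaseChange K s) := by
  rw [pointToBaseChange_eq_baseChange]
  exact (Affine.Point.baseChange (W' := V) ℚ K).isOfFinAddOrder hs

/-- Coefficients with respect to a two-element Mordell–Weil basis are unique modulo torsion: if
`x•B₀ + y•B₁` has finite order then `x = y = 0` (linear independence of `B` in `V(K)/tors`).
[folklore] -/
theorem eq_zero_of_isOfFinAddOrder_comb_two {B : Fin 2 → (V.baseChange K).toAffine.Point}
    (hB : IsMordellWeilBasis B) {x y : ℤ} (h : IsOfFinAddOrder (x • B 0 + y • B 1)) :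
    x = 0 ∧ y = 0 := by
  have h0 : (QuotientAddGroup.mk (x • B 0 + y • B 1) : mordellWeilModTorsion (V.baseChange K)) = 0 :=
    (QuotientAddGroup.eq_zero_iff _).mpr ((AddCommGroup.mem_torsion _).mpr h)
  rw [QuotientAddGroup.mk_add, QuotientAddGroup.mk_zsmul, QuotientAddGroup.mk_zsmul] at h0
  have hli := Fintype.linearIndependent_iff.mp hB.1 ![x, y] (by
    rw [Fin.sum_univ_two]
    simpa only [Function.comp_apply, Matrix.cons_val_zero, Matrix.cons_val_one,
      Matrix.head_cons] using h0)
  exact ⟨by simpa using hli 0, by simpa using hli 1⟩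

end Bookkeeping

/-! ## §2 Rank `(1,0)`: the index of a height-doubling transport divides `2` -/

section RankOneZero

variable (K : Type) [Field K] [NumberField K] (V : WeierstrassCurve ℚ) [V.IsElliptic]
  (W : WeierstrassCurve ℚ) [W.IsElliptic]

omit [W.IsElliptic] in
/-- **The index lemma in rank `(1,0)`.** `K` a quadratic number field, `W = C • V^{(d_K)}`, `V(ℚ)`
FINITE, `{P₁}` a Mordell–Weil basis of `W(ℚ)`, `{Q}` one of `V(K)`, and `Tr : W(ℚ) →+ V(K)` ANY
additive map doubling Néron–Tate heights (`⟨Tr P, Tr P⟩_K = 2⟨P,P⟩_ℚ`), `Tr P₁ = m•Q + t` with `t`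
torsion. Then **`m ∣ 2`**: for the canonical transport `Φ` of `exists_conj_twistTransport_decomp`,
`ΦP₁ = m₀•Q + t₀` and `2Q = ιv + Φw` with `ιv` torsion (`V(ℚ)` finite) and `w = kP₁ + s`, so
`(2 − km₀)•Q` is torsion and `km₀ = 2`; and `m²·⟨Q,Q⟩ = 2⟨P₁,P₁⟩ = m₀²·⟨Q,Q⟩`
(`heightPairing_twistGenerator_eq`) with `⟨Q,Q⟩ = Reg(V_K) > 0`, so `m = ±m₀`.
[cite: SilvermanAEC2009, Exercise 10.16, Prop. VIII.5.4(b), Thm. VIII.9.3] -/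
theorem twistTransport_index_dvd_two (h2 : Module.finrank ℚ K = 2)
    {C : VariableChange ℚ} (hC : C • V.quadraticTwist (NumberField.discr K : ℚ) = W)
    [Finite V.toAffine.Point]
    {P₁ : W.toAffine.Point} (hP₁ : IsMordellWeilBasis (fun _ : Fin 1 => P₁))
    {Q : (V.baseChange K).toAffine.Point} (hQ : IsMordellWeilBasis (fun _ : Fin 1 => Q))
    (Tr : W.toAffine.Point →+ (V.baseChange K).toAffine.Point)
    (hTr : ∀ P : W.toAffine.Point, heightPairing (Tr P) (Tr P) = 2 * heightPairing P P)
    {m : ℤ} {t : (V.baseChange K).toAffine.Point} (ht : IsOfFinAddOrder t) (hmQ : Tr P₁ = m • Q + t) :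
    m ∣ 2 := by
  haveI : NeZero (2 : ℚ) := ⟨two_ne_zero⟩
  haveI : (V.baseChange K).IsElliptic := by rw [WeierstrassCurve.baseChange]; infer_instance
  obtain ⟨θ, c, hθ, hc⟩ := Quadratic.exists_sq_eq_algebraMap (F := ℚ) (K := K) h2
  obtain ⟨q, hq, hd⟩ := NumberField.exists_discr_eq_mul_sq h2 hθ hc
  obtain ⟨Cq, hCq⟩ := V.exists_variableChange_quadraticTwist_mul_sq c q hq
  have hC' : (C * Cq) • V.quadraticTwist c = W := by rw [mul_smul, hCq, ← hd]; exact hC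
  obtain ⟨σ, Φ, -, -, hΦ, -, -, -, hdec⟩ := exists_conj_twistTransport_decomp K V W h2 hθ hc (C * Cq) hC'
  obtain ⟨m₀, t₀, ht₀, hm₀Q⟩ := exists_eq_zsmul_add_torsion_of_isMordellWeilBasis_one hQ (Φ P₁)
  have hQinf : ¬ IsOfFinAddOrder Q := not_isOfFinAddOrder_of_isMordellWeilBasis_one hQ
  -- `m₀ ∣ 2` from the decomposition of `Q`
  have hm₀ : m₀ ∣ 2 := by
    obtain ⟨v, w, hvw⟩ := hdec Q
    obtain ⟨k, s, hs, hkw⟩ := exists_eq_zsmul_add_torsion_one_of_decEq instDecidableEqRat hP₁ w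
    have hv : IsOfFinAddOrder (V.pointToBaseChange K v) :=
      isOfFinAddOrder_pointToBaseChange K V (isOfFinAddOrder_of_finite v)
    have e : ((2 : ℤ) - k * m₀) • Q = V.pointToBaseChange K v + (k • t₀ + Φ s) := by
      rw [sub_zsmul, hvw, hkw, map_add Φ, map_zsmul Φ, hm₀Q]
      simp only [mul_zsmul, zsmul_add]
      abel
    have htor : IsOfFinAddOrder (((2 : ℤ) - k * m₀) • Q) := by
      rw [e]
      exact hv.add ((ht₀.zsmul).add (Φ.isOfFinAddOrder hs))
    have h0 : (2 : ℤ) - k * m₀ = 0 := by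
      by_contra hne
      exact hQinf (isOfFinAddOrder_of_zsmul hne htor)
    exact Dvd.intro_left k (by linarith)
  -- `m² = m₀²` from the heights
  have h₁ := heightPairing_twistGenerator_eq K V W Tr hTr ht hmQ
  have h₀ := heightPairing_twistGenerator_eq K V W Φ hΦ ht₀ hm₀Q
  have hpos : 0 < heightPairing Q Q := by
    rw [← regulator_eq_heightPairing_of_isMordellWeilBasis_one hQ]
    exact regulator_pos_holds _
  have hsq : (m : ℝ) ^ 2 = (m₀ : ℝ) ^ 2 := mul_right_cancel₀ hpos.ne' (h₁.trans h₀.symm)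
  have hsqZ : m ^ 2 = m₀ ^ 2 := by exact_mod_cast hsq
  have habs : m.natAbs = m₀.natAbs := Int.natAbs_eq_iff_sq_eq.mpr hsqZ
  have hmm₀ : m ∣ m₀ := Int.natAbs_dvd_natAbs.mp (by rw [habs])
  exact hmm₀.trans hm₀

omit [W.IsElliptic] in
/-- **Corollary: the index is a `p`-adic unit for odd `p`** (rank `(1,0)`): in the situation of
`twistTransport_index_dvd_two`, `m ≠ 0` and `padicValRat p m = 0` for every prime `p ≠ 2`.
[cite: SilvermanAEC2009, Exercise 10.16] -/
theorem padicValRat_twistTransport_index_eq_zero (h2 : Module.finrank ℚ K = 2)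
    (p : ℕ) [Fact p.Prime] (hp : p ≠ 2)
    {C : VariableChange ℚ} (hC : C • V.quadraticTwist (NumberField.discr K : ℚ) = W)
    [Finite V.toAffine.Point]
    {P₁ : W.toAffine.Point} (hP₁ : IsMordellWeilBasis (fun _ : Fin 1 => P₁))
    {Q : (V.baseChange K).toAffine.Point} (hQ : IsMordellWeilBasis (fun _ : Fin 1 => Q))
    (Tr : W.toAffine.Point →+ (V.baseChange K).toAffine.Point)
    (hTr : ∀ P : W.toAffine.Point, heightPairing (Tr P) (Tr P) = 2 * heightPairing P P)
    {m : ℤ} {t : (V.baseChange K).toAffine.Point} (ht : IsOfFinAddOrder t) (hmQ : Tr P₁ = m • Q + t) :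
    m ≠ 0 ∧ padicValRat p (m : ℚ) = 0 := by
  have hm2 : m ∣ 2 := twistTransport_index_dvd_two K V W h2 hC hP₁ hQ Tr hTr ht hmQ
  have hm0 : m ≠ 0 := by
    rintro rfl
    exact absurd (zero_dvd_iff.mp hm2) two_ne_zero
  refine ⟨hm0, ?_⟩
  have hpm : ¬ (p : ℤ) ∣ m := by
    intro hpm
    have hp2 : (p : ℤ) ∣ 2 := hpm.trans hm2
    have hle : p ≤ 2 := Nat.le_of_dvd two_pos (by exact_mod_cast hp2)
    exact hp (le_antisymm hle (Fact.out : p.Prime).two_le)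
  rw [show (m : ℚ) = ((m : ℤ) : ℚ) from rfl, padicValRat.of_int]
  exact_mod_cast padicValInt.eq_zero_of_not_dvd hpm

end RankOneZero

/-! ## §3 Rank `(1,1)`: the index determinant of `⟨ιP₀, ΦP₁⟩` divides `4` -/

section RankOneOne

variable (K : Type) [Field K] [NumberField K] (V : WeierstrassCurve ℚ) [V.IsElliptic]
  (W : WeierstrassCurve ℚ) [W.IsElliptic]

/-- **The index lemma in rank `(1,1)`.** `K` a quadratic number field, `W = C • V^{(d_K)}`, `{P₀}`,
`{P₁}`, `B = (B₀,B₁)` Mordell–Weil bases of `V(ℚ)`, `W(ℚ)`, `V(K)`, ANY algebra endomorphism `σ` of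
`K` and ANY additive `Φ : W(ℚ) →+ V(K)` doubling Néron–Tate heights with `σ_*(ΦP) = −ΦP`,
`ιP₀ = aB₀ + bB₁ + t`, `ΦP₁ = cB₀ + dB₁ + t'` (`t, t'` torsion). Then **`ad − bc ∣ 4`**: for the
canonical pair `(σ₀, Φ₀)` of `exists_conj_twistTransport_decomp` (`Φ₀P₁ = c₀B₀ + d₀B₁ + t₀`) the
decompositions `2Bᵢ = ιvᵢ + Φ₀wᵢ`, `vᵢ = kᵢP₀ + …`, `wᵢ = lᵢP₁ + …` give
`(kᵢ lᵢ)·(a b; c₀ d₀) = 2·Id` modulo torsion, so `(k₀l₁ − k₁l₀)(ad₀ − bc₀) = 4`; and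
`M²·Reg(V_K) = 4Reg(V)Reg(W) = M₀²·Reg(V_K)` (`sq_mul_regulator_baseChange_eq_rankOneOne`, Galois
orthogonality) with `Reg(V_K) > 0`, so `M = ±M₀`.
[cite: SilvermanAEC2009, Exercise 10.16, Prop. VIII.5.4(b), Thm. VIII.9.3] [cite: BombieriGubler2001, Prop. 1.5.17] -/
theorem twistTransport_indexDet_dvd_four (h2 : Module.finrank ℚ K = 2)
    {C : VariableChange ℚ} (hC : C • V.quadraticTwist (NumberField.discr K : ℚ) = W)
    {P₀ : V.toAffine.Point} (hP₀ : IsMordellWeilBasis (fun _ : Fin 1 => P₀))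
    {P₁ : W.toAffine.Point} (hP₁ : IsMordellWeilBasis (fun _ : Fin 1 => P₁))
    {B : Fin 2 → (V.baseChange K).toAffine.Point} (hB : IsMordellWeilBasis B)
    (σ : K →ₐ[ℚ] K) (Φ : W.toAffine.Point →+ (V.baseChange K).toAffine.Point)
    (hΦ : ∀ P : W.toAffine.Point, heightPairing (Φ P) (Φ P) = 2 * heightPairing P P)
    (hΦσ : ∀ P : W.toAffine.Point, QuadraticDescent.conjMap V σ (Φ P) = -Φ P)
    {a b c d : ℤ} {t t' : (V.baseChange K).toAffine.Point} (ht : IsOfFinAddOrder t)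
    (ht' : IsOfFinAddOrder t') (hx : V.pointToBaseChange K P₀ = a • B 0 + b • B 1 + t)
    (hy : Φ P₁ = c • B 0 + d • B 1 + t') :
    a * d - b * c ∣ 4 := by
  haveI : NeZero (2 : ℚ) := ⟨two_ne_zero⟩
  haveI : (V.baseChange K).IsElliptic := by rw [WeierstrassCurve.baseChange]; infer_instance
  obtain ⟨θ, c', hθ, hc'⟩ := Quadratic.exists_sq_eq_algebraMap (F := ℚ) (K := K) h2
  obtain ⟨q, hq, hd⟩ := NumberField.exists_discr_eq_mul_sq h2 hθ hc'
  obtain ⟨Cq, hCq⟩ := V.exists_variableChange_quadraticTwist_mul_sq c' q hq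
  have hC' : (C * Cq) • V.quadraticTwist c' = W := by rw [mul_smul, hCq, ← hd]; exact hC
  obtain ⟨σ₀, Φ₀, -, -, hΦ₀, hΦ₀σ, -, -, hdec⟩ :=
    exists_conj_twistTransport_decomp K V W h2 hθ hc' (C * Cq) hC'
  obtain ⟨c₀, d₀, t₀, ht₀, hy₀⟩ := exists_eq_comb_add_torsion_of_isMordellWeilBasis_two hB (Φ₀ P₁)
  -- the matrix of `(2B₀, 2B₁)` in `(ιP₀, Φ₀P₁)` is integral: `M₀ ∣ 4`
  have hM₀ : a * d₀ - b * c₀ ∣ 4 := by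
    -- decomposition of `B i`: `2•B i = k•ιP₀ + l•Φ₀P₁ + torsion`
    have hrow : ∀ i : Fin 2, ∃ k l : ℤ, ∃ s : (V.baseChange K).toAffine.Point, IsOfFinAddOrder s ∧
        (2 : ℤ) • B i = (k * a + l * c₀) • B 0 + (k * b + l * d₀) • B 1 + s := by
      intro i
      obtain ⟨v, w, hvw⟩ := hdec (B i)
      obtain ⟨k, s, hs, hkv⟩ := exists_eq_zsmul_add_torsion_one_of_decEq instDecidableEqRat hP₀ v
      obtain ⟨l, s', hs', hlw⟩ := exists_eq_zsmul_add_torsion_one_of_decEq instDecidableEqRat hP₁ w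
      refine ⟨k, l, V.pointToBaseChange K s + (k • t + (l • t₀ + Φ₀ s')), ?_, ?_⟩
      · exact (isOfFinAddOrder_pointToBaseChange K V hs).add
          ((ht.zsmul).add ((ht₀.zsmul).add (Φ₀.isOfFinAddOrder hs')))
      · rw [hvw, hkv, hlw, pointToBaseChange_zsmul_add, map_add Φ₀, map_zsmul Φ₀, hx, hy₀]
        simp only [add_zsmul, mul_zsmul, zsmul_add]
        abel
    obtain ⟨k₀, l₀, s₀, hs₀, h0⟩ := hrow 0
    obtain ⟨k₁, l₁, s₁, hs₁, h1⟩ := hrow 1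
    -- compare coefficients modulo torsion
    have e0 : IsOfFinAddOrder ((k₀ * a + l₀ * c₀ - 2) • B 0 + (k₀ * b + l₀ * d₀) • B 1) := by
      have e : (k₀ * a + l₀ * c₀ - 2) • B 0 + (k₀ * b + l₀ * d₀) • B 1 = -s₀ := by
        rw [sub_zsmul, h0]
        abel
      rw [e]; exact hs₀.neg
    have e1 : IsOfFinAddOrder ((k₁ * a + l₁ * c₀) • B 0 + (k₁ * b + l₁ * d₀ - 2) • B 1) := by
      have e : (k₁ * a + l₁ * c₀) • B 0 + (k₁ * b + l₁ * d₀ - 2) • B 1 = -s₁ := by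
        rw [sub_zsmul, h1]
        abel
      rw [e]; exact hs₁.neg
    obtain ⟨h00, h01⟩ := eq_zero_of_isOfFinAddOrder_comb_two K V hB e0
    obtain ⟨h10, h11⟩ := eq_zero_of_isOfFinAddOrder_comb_two K V hB e1
    exact Dvd.intro_left (k₀ * l₁ - k₁ * l₀) (by
      linear_combination (k₁ * b + l₁ * d₀) * h00 + 2 * h11 - (k₁ * a + l₁ * c₀) * h01)
  -- `M² = M₀²` from the regulator factorisations
  have hR := sq_mul_regulator_baseChange_eq_rankOneOne K V W h2 hP₀ hP₁ hB σ Φ hΦ hΦσ ht ht' hx hy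
  have hR₀ := sq_mul_regulator_baseChange_eq_rankOneOne K V W h2 hP₀ hP₁ hB σ₀ Φ₀ hΦ₀ hΦ₀σ ht ht₀ hx hy₀
  have hpos : 0 < (V.baseChange K).regulator := regulator_pos_holds _
  have hsq : ((a * d - b * c : ℤ) : ℝ) ^ 2 = ((a * d₀ - b * c₀ : ℤ) : ℝ) ^ 2 :=
    mul_right_cancel₀ hpos.ne' (hR.trans hR₀.symm)
  have hsqZ : (a * d - b * c) ^ 2 = (a * d₀ - b * c₀) ^ 2 := by exact_mod_cast hsq
  have habs : (a * d - b * c).natAbs = (a * d₀ - b * c₀).natAbs := Int.natAbs_eq_iff_sq_eq.mpr hsqZ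
  have hdvd : a * d - b * c ∣ a * d₀ - b * c₀ := Int.natAbs_dvd_natAbs.mp (by rw [habs])
  exact hdvd.trans hM₀

/-- **Corollary: the index determinant is a `p`-adic unit for odd `p`** (rank `(1,1)`): in the
situation of `twistTransport_indexDet_dvd_four`, `padicValRat p (ad − bc) = 0` for every prime `p ≠ 2`.
[cite: SilvermanAEC2009, Exercise 10.16] -/
theorem padicValRat_twistTransport_indexDet_eq_zero (h2 : Module.finrank ℚ K = 2)
    (p : ℕ) [Fact p.Prime] (hp : p ≠ 2)
    {C : VariableChange ℚ} (hC : C • V.quadraticTwist (NumberField.discr K : ℚ) = W)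
    {P₀ : V.toAffine.Point} (hP₀ : IsMordellWeilBasis (fun _ : Fin 1 => P₀))
    {P₁ : W.toAffine.Point} (hP₁ : IsMordellWeilBasis (fun _ : Fin 1 => P₁))
    {B : Fin 2 → (V.baseChange K).toAffine.Point} (hB : IsMordellWeilBasis B)
    (σ : K →ₐ[ℚ] K) (Φ : W.toAffine.Point →+ (V.baseChange K).toAffine.Point)
    (hΦ : ∀ P : W.toAffine.Point, heightPairing (Φ P) (Φ P) = 2 * heightPairing P P)
    (hΦσ : ∀ P : W.toAffine.Point, QuadraticDescent.conjMap V σ (Φ P) = -Φ P)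
    {a b c d : ℤ} {t t' : (V.baseChange K).toAffine.Point} (ht : IsOfFinAddOrder t)
    (ht' : IsOfFinAddOrder t') (hx : V.pointToBaseChange K P₀ = a • B 0 + b • B 1 + t)
    (hy : Φ P₁ = c • B 0 + d • B 1 + t') :
    padicValRat p ((a * d - b * c : ℤ) : ℚ) = 0 := by
  have hM4 : a * d - b * c ∣ 4 :=
    twistTransport_indexDet_dvd_four K V W h2 hC hP₀ hP₁ hB σ Φ hΦ hΦσ ht ht' hx hy
  have hpM : ¬ (p : ℤ) ∣ a * d - b * c := by
    intro hpM
    have hp4 : (p : ℤ) ∣ 4 := hpM.trans hM4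
    have hp4' : p ∣ 4 := by exact_mod_cast hp4
    have h4 : (4 : ℕ) = 2 ^ 2 := by norm_num
    rw [h4] at hp4'
    have hle : p ≤ 2 := Nat.le_of_dvd two_pos ((Fact.out : p.Prime).dvd_of_dvd_pow hp4')
    exact hp (le_antisymm hle (Fact.out : p.Prime).two_le)
  rw [padicValRat.of_int]
  exact_mod_cast padicValInt.eq_zero_of_not_dvd hpM

end RankOneOne

end Summit.BirchSwinnertonDyer.Rank1Residual.Additive

end
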